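import Mathlib.RepresentationTheory.Character
import Literature.RepresentationTheory.FiniteGroups.WordIsotypicProjectors
import Literature.NumberTheory.DiophantineGeometry.SymmetricGroupRepsNonemptyEquivIffProofs
import HarnessLib

/-!
# Weights of the isotypic projectors `P_λ` on `(ℂ^N)^{⊗n}` are dominated by `λ`

Topic `Literature/RepresentationTheory/FiniteGroups`. For the isotypic projector `P_λ` of `𝔖ₙ` on
the word space `Word N n → ℂ` (`wordIsotypicMatrix`, `WordIsotypicProjectors.lean`) we PROVE the
**majorisation property** (Christandl–Vrana–Zuiddam, J. Amer. Math. Soc. 36 (2023), Rem. 3.33: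
"`P_λ^V v_i ≠ 0` implies `nQ ≺ λ` where `Q` is the type of `i`"; equivalently, the weights of the
`λ`-isotypic component `S_λ(V) ⊗ [λ]` of `V^{⊗n}` are dominated by `λ`) in the form needed for the
spectrum-estimation bound: if the diagonal entry `(P_λ)_{w,w}` at a word `w` is nonzero, then for
every `a` the number of positions of `w` carrying a letter `< a` is at most `λ₁ + ⋯ + λ_a`
(`= #{j | rowOf_λ j < a}`, the number of boxes in the first `a` rows):

* `wordIsotypicMatrix_diag_eq` — `(P_λ)_{w,w} = (f^λ/n!) ∑_{σ ∈ Stab(w)} χ^λ(σ)` (`Stab(w)`, the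
  stabiliser `wordStabilizer w` of the word, a Young subgroup; `stabFinset w` as a `Finset`);
* `sum_spechtCharacter_wordStabilizer` — `∑_{σ ∈ Stab(w)} χ^λ(σ) = |Stab(w)| · dim (S^λ)^{Stab(w)}`
  (Mathlib's `Representation.card_inv_mul_sum_char_eq_finrank` for the restricted Specht module);
* `exists_stabSymmetrizer_mul_mul_colAntisymmetrizer_ne_zero` — a nonzero `Stab(w)`-invariant of
  `S^λ = ℂ[𝔖ₙ] c_λ` gives `a_w · z · b_λ ≠ 0` for some `z` (`a_w = ∑_{σ ∈ Stab(w)} σ`);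
* `stabSymmetrizer_mul_mul_colAntisymmetrizer_eq_zero` — the tree's engine (Fulton–Harris
  Lemma 4.23 (1), `rowSymmetrizer_mul_of_mul_colAntisymmetrizer_eq_zero` of
  `SymmetricGroupRepsNonemptyEquivIffProofs.lean`) with the row group replaced by `Stab(w)`: if
  every `g` puts two positions with equal letters into one column of `g T_λ`, then `a_w z b_λ = 0`;
* `card_filter_lt_le_of_wordIsotypicMatrix_diag_ne_zero` — the conclusion, via a good `g` and
  `lowCount_le_of_isColStrict` (`SchurWeylHighestWeightProofs.lean`).

Also `wordIsotypicMatrix_diag_nonneg` (the diagonal entries are nonnegative, `P_λ ≥ 0`, in the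
`ComplexOrder`).

## References

* M. Christandl, P. Vrana, J. Zuiddam, J. Amer. Math. Soc. 36 (2023) = arXiv:1709.07851v3,
  Rem. 3.33 (majorisation property). [ChristandlVranaZuiddam2023]
* W. Fulton, J. Harris, *Representation Theory*, GTM 129, Lemma 4.23 (1) and its proof.
  [FultonHarrisGTM129]
* W. Fulton, *Young Tableaux*, §8.2 (proof of Lemma 4: column-strict words are dominated).
  [FultonYoungTableaux1997]
-/

noncomputable section

open scoped BigOperators Matrix ComplexOrder
open Module
open Literature.NumberTheory.DiophantineGeometry (Word spechtRep spechtIdeal spechtCharacter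
  spechtRep_apply youngSymmetrizer rowSymmetrizer colAntisymmetrizer colStabilizer
  swap_mem_colStabilizer of_mul_colAntisymmetrizer lowCount IsColStrict lowCount_le_of_isColStrict)

namespace Literature.RepresentationTheory.FiniteGroups

variable {N n : ℕ}

/-! ### The stabiliser of a word and its symmetrizer -/

/-- The stabiliser `Stab(w) = {σ | w ∘ σ = w} ≤ 𝔖ₙ` of a word (a Young subgroup: the letters
partition the positions). [folklore] -/
def wordStabilizer (w : Word N n) : Subgroup (Equiv.Perm (Fin n)) where
  carrier := {σ | ∀ p, w (σ p) = w p}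
  one_mem' := fun _ => rfl
  mul_mem' {σ τ} hσ hτ p := by rw [Equiv.Perm.mul_apply, hσ, hτ]
  inv_mem' {σ} hσ p := by rw [← hσ (σ⁻¹ p), Equiv.Perm.coe_inv, Equiv.apply_symm_apply]

/-- Membership in the stabiliser. [folklore] -/
@[simp] theorem mem_wordStabilizer_iff (w : Word N n) (σ : Equiv.Perm (Fin n)) :
    σ ∈ wordStabilizer w ↔ ∀ p, w (σ p) = w p := Iff.rfl

/-- Membership in the stabiliser is decidable (a finite conjunction). [folklore] -/
instance decidableMemWordStabilizer (w : Word N n) : DecidablePred (· ∈ wordStabilizer w) :=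
  fun σ => inferInstanceAs (Decidable (∀ p, w (σ p) = w p))

/-- `σ ∈ Stab(w)` iff `w ∘ σ = w`. [folklore] -/
theorem mem_wordStabilizer_iff_comp (w : Word N n) (σ : Equiv.Perm (Fin n)) :
    σ ∈ wordStabilizer w ↔ w ∘ ⇑σ = w :=
  ⟨fun h => funext h, fun h p => congr_fun h p⟩

/-- A transposition of two positions with the same letter stabilises the word. [folklore] -/
theorem swap_mem_wordStabilizer (w : Word N n) {x y : Fin n} (h : w x = w y) :
    Equiv.swap x y ∈ wordStabilizer w := by
  intro p
  rcases eq_or_ne p x with rfl | hpx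
  · rw [Equiv.swap_apply_left]; exact h.symm
  rcases eq_or_ne p y with rfl | hpy
  · rw [Equiv.swap_apply_right]; exact h
  rw [Equiv.swap_apply_of_ne_of_ne hpx hpy]

/-- The stabiliser as a `Finset`. [folklore] -/
def stabFinset (w : Word N n) : Finset (Equiv.Perm (Fin n)) :=
  Finset.univ.filter (· ∈ wordStabilizer w)

/-- Membership in `stabFinset`. [folklore] -/
@[simp] theorem mem_stabFinset (w : Word N n) (σ : Equiv.Perm (Fin n)) :
    σ ∈ stabFinset w ↔ σ ∈ wordStabilizer w := by
  simp [stabFinset]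

/-- `|stabFinset w| = |Stab(w)|`. [folklore] -/
theorem card_stabFinset (w : Word N n) : (stabFinset w).card = Nat.card (wordStabilizer w) := by
  rw [Nat.card_eq_fintype_card, Fintype.card_subtype]
  rfl

/-- The stabiliser is nonempty (it contains `1`). [folklore] -/
theorem card_stabFinset_pos (w : Word N n) : 0 < (stabFinset w).card :=
  Finset.card_pos.2 ⟨1, (mem_stabFinset w 1).2 (wordStabilizer w).one_mem⟩

/-- The symmetrizer `a_w = ∑_{σ ∈ Stab(w)} σ ∈ ℂ[𝔖ₙ]` of the stabiliser of a word (the row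
symmetrizer of a Young subgroup). [folklore] -/
def stabSymmetrizer (w : Word N n) : MonoidAlgebra ℂ (Equiv.Perm (Fin n)) :=
  ∑ σ ∈ stabFinset w, MonoidAlgebra.of ℂ _ σ

/-- `a_w · t = a_w` for `t ∈ Stab(w)`. [folklore] -/
theorem stabSymmetrizer_mul_of (w : Word N n) {t : Equiv.Perm (Fin n)} (ht : t ∈ wordStabilizer w) :
    stabSymmetrizer w * MonoidAlgebra.of ℂ _ t = stabSymmetrizer w := by
  unfold stabSymmetrizer
  rw [Finset.sum_mul]
  refine Finset.sum_equiv (Equiv.mulRight t) (fun σ => ?_) (fun σ _ => ?_)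
  · simp only [Equiv.coe_mulRight, mem_stabFinset]
    constructor
    · exact fun h => (wordStabilizer w).mul_mem h ht
    · intro h
      have := (wordStabilizer w).mul_mem h ((wordStabilizer w).inv_mem ht)
      rwa [mul_inv_cancel_right] at this
  · rw [Equiv.coe_mulRight, map_mul]

/-- `a_w` acts on a `Stab(w)`-fixed element `v` of the group algebra as `|Stab(w)| · v`.
[folklore] -/
theorem stabSymmetrizer_mul_eq_card_smul (w : Word N n) {v : MonoidAlgebra ℂ (Equiv.Perm (Fin n))}
    (hv : ∀ σ ∈ wordStabilizer w, MonoidAlgebra.of ℂ _ σ * v = v) :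
    stabSymmetrizer w * v = ((stabFinset w).card : ℂ) • v := by
  unfold stabSymmetrizer
  rw [Finset.sum_mul, Finset.sum_congr rfl fun σ hσ => hv σ ((mem_stabFinset w σ).1 hσ),
    Finset.sum_const, ← Nat.cast_smul_eq_nsmul ℂ]

/-- The Specht module `S^λ` restricted to the stabiliser of a word. [folklore] -/
abbrev spechtRepStab (lam : Nat.Partition n) (w : Word N n) :
    Representation ℂ (wordStabilizer w) (spechtIdeal ℂ lam) :=
  (spechtRep ℂ lam).comp (wordStabilizer w).subtype

/-! ### The diagonal entries of `P_λ` -/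

/-- **`(P_λ)_{w,w} = (f^λ/n!) ∑_{σ ∈ Stab(w)} χ^λ(σ)`**.
[cite: ChristandlVranaZuiddam2023, Rem. 3.33] -/
theorem wordIsotypicMatrix_diag_eq (lam : Nat.Partition n) (w : Word N n) :
    wordIsotypicMatrix N n lam w w = spechtCharacter ℂ lam 1 / Fintype.card (Equiv.Perm (Fin n)) *
      ∑ σ ∈ stabFinset w, spechtCharacter ℂ lam σ := by
  rw [wordIsotypicMatrix_apply, Finset.mul_sum, ← Finset.sum_filter]
  refine Finset.sum_congr ?_ fun t _ => rfl
  ext t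
  simp only [Finset.mem_filter, Finset.mem_univ, true_and, mem_stabFinset]
  rw [eq_comm, ← mem_wordStabilizer_iff_comp]
  constructor
  · intro h
    simpa using (wordStabilizer w).inv_mem h
  · exact fun h => (wordStabilizer w).inv_mem h

/-- **The diagonal entries of `P_λ` are real and nonnegative** (`P_λ ≥ 0`). [folklore] -/
theorem wordIsotypicMatrix_diag_nonneg (lam : Nat.Partition n) (w : Word N n) :
    0 ≤ wordIsotypicMatrix N n lam w w :=
  (posSemidef_wordIsotypicMatrix (N := N) lam).diag_nonneg

/-! ### From a nonzero diagonal entry to a nonzero `a_w z b_λ` -/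

/-- **`∑_{σ ∈ Stab(w)} χ^λ(σ) = |Stab(w)| · dim (S^λ)^{Stab(w)}`** (the multiplicity of the trivial
representation in the restriction; Mathlib `card_inv_mul_sum_char_eq_finrank`). [folklore] -/
theorem sum_spechtCharacter_wordStabilizer (lam : Nat.Partition n) (w : Word N n) :
    ∑ σ ∈ stabFinset w, spechtCharacter ℂ lam σ =
      ((stabFinset w).card : ℂ) * finrank ℂ (spechtRepStab lam w).invariants := by
  haveI : Invertible (Nat.card (wordStabilizer w) : ℂ) :=
    invertibleOfNonzero (Nat.cast_ne_zero.2 Nat.card_pos.ne')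
  have h := Representation.card_inv_mul_sum_char_eq_finrank (spechtRepStab lam w)
  have hsum : ∑ σ : wordStabilizer w, (spechtRepStab lam w).character σ =
      ∑ σ ∈ stabFinset w, spechtCharacter ℂ lam σ := by
    rw [Finset.sum_subtype (stabFinset w) (p := fun σ => σ ∈ wordStabilizer w)
      (fun σ => mem_stabFinset w σ)]
    rfl
  rw [hsum, ← card_stabFinset] at h
  rw [← h, ← mul_assoc, mul_inv_cancel₀ (Nat.cast_ne_zero.2 (card_stabFinset_pos w).ne'), one_mul]

/-- If `∑_{σ ∈ Stab(w)} χ^λ(σ) ≠ 0` then `S^λ` has a nonzero `Stab(w)`-invariant vector, and hence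
**`a_w · z · b_λ ≠ 0` for some `z`**: for the invariant `v = z' c_λ`, `a_w v = |Stab(w)| v ≠ 0` and
`c_λ = a_λ b_λ`. [cite: FultonHarrisGTM129, Lemma 4.23 (1)] -/
theorem exists_stabSymmetrizer_mul_mul_colAntisymmetrizer_ne_zero (lam : Nat.Partition n)
    (w : Word N n) (h : ∑ σ ∈ stabFinset w, spechtCharacter ℂ lam σ ≠ 0) :
    ∃ z : MonoidAlgebra ℂ (Equiv.Perm (Fin n)),
      stabSymmetrizer w * z * colAntisymmetrizer ℂ lam ≠ 0 := by
  classical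
  rw [sum_spechtCharacter_wordStabilizer] at h
  have hfin : finrank ℂ (spechtRepStab lam w).invariants ≠ 0 := by
    intro h0
    apply h
    rw [h0, Nat.cast_zero, mul_zero]
  obtain ⟨v, hv, hv0⟩ : ∃ v ∈ (spechtRepStab lam w).invariants, v ≠ 0 := by
    by_contra hne
    push Not at hne
    apply hfin
    have : (spechtRepStab lam w).invariants = ⊥ := (Submodule.eq_bot_iff _).2 hne
    rw [this, finrank_bot]
  -- `v ∈ S^λ = ℂ[𝔖ₙ] c_λ` is fixed by `Stab(w)`
  have hfix : ∀ σ ∈ wordStabilizer w,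
      MonoidAlgebra.of ℂ _ σ * (v : MonoidAlgebra ℂ (Equiv.Perm (Fin n))) = v := by
    intro σ hσ
    have h1 := congrArg Subtype.val (hv ⟨σ, hσ⟩)
    rw [← spechtRep_apply ℂ lam σ v]
    exact h1
  have hav : stabSymmetrizer w * (v : MonoidAlgebra ℂ (Equiv.Perm (Fin n))) ≠ 0 := by
    rw [stabSymmetrizer_mul_eq_card_smul w hfix]
    exact smul_ne_zero (Nat.cast_ne_zero.2 (card_stabFinset_pos w).ne')
      (fun h0 => hv0 ((Submodule.coe_eq_zero).1 h0))
  -- `v = z' c_λ` and `c_λ = a_λ b_λ`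
  have hv2 : (v : MonoidAlgebra ℂ (Equiv.Perm (Fin n))) ∈ Ideal.span {youngSymmetrizer ℂ lam} :=
    v.2
  obtain ⟨z', hz'⟩ := Ideal.mem_span_singleton'.1 hv2
  refine ⟨z' * rowSymmetrizer ℂ lam, ?_⟩
  have hc : youngSymmetrizer ℂ lam = rowSymmetrizer ℂ lam * colAntisymmetrizer ℂ lam := rfl
  have heq : stabSymmetrizer w * (z' * rowSymmetrizer ℂ lam) * colAntisymmetrizer ℂ lam =
      stabSymmetrizer w * (v : MonoidAlgebra ℂ (Equiv.Perm (Fin n))) := by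
    rw [← hz', hc]
    simp only [mul_assoc]
  rw [heq]
  exact hav

/-! ### The engine: `a_w z b_λ = 0` unless some `g` separates equal letters into distinct columns -/

/-- **Fulton–Harris, Lemma 4.23 (1), proof, for the stabiliser of a word**: if two positions
`x ≠ y` carry the same letter of `w` and `g⁻¹ x, g⁻¹ y` lie in one column of `T_λ`, then
`a_w · g · b_λ = 0` (`a_w t = a_w` for the transposition `t = (x y) ∈ Stab(w)` and
`(g⁻¹ t g) b_λ = -b_λ`). [cite: FultonHarrisGTM129, Lemma 4.23 (1) (proof)] -/
theorem stabSymmetrizer_mul_of_mul_colAntisymmetrizer_eq_zero {lam : Nat.Partition n} {w : Word N n}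
    {g : Equiv.Perm (Fin n)} {x y : Fin n} (hxy : x ≠ y) (hw : w x = w y)
    (hcol : lam.colOf (g⁻¹ x) = lam.colOf (g⁻¹ y)) :
    stabSymmetrizer w * MonoidAlgebra.of ℂ _ g * colAntisymmetrizer ℂ lam = 0 := by
  set X := stabSymmetrizer w * MonoidAlgebra.of ℂ _ g * colAntisymmetrizer ℂ lam with hX
  have ht : Equiv.swap x y ∈ wordStabilizer w := swap_mem_wordStabilizer w hw
  have ht' : Equiv.swap (g⁻¹ x) (g⁻¹ y) ∈ colStabilizer lam := swap_mem_colStabilizer lam hcol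
  have hsgn : Equiv.Perm.sign (Equiv.swap (g⁻¹ x) (g⁻¹ y)) = -1 :=
    Equiv.Perm.sign_swap (g⁻¹.injective.ne hxy)
  have hneg : X = -X := by
    calc X = stabSymmetrizer w * MonoidAlgebra.of ℂ _ (Equiv.swap x y) *
          MonoidAlgebra.of ℂ _ g * colAntisymmetrizer ℂ lam := by
          rw [stabSymmetrizer_mul_of w ht]
      _ = stabSymmetrizer w * MonoidAlgebra.of ℂ _ g *
          (MonoidAlgebra.of ℂ _ (Equiv.swap (g⁻¹ x) (g⁻¹ y)) * colAntisymmetrizer ℂ lam) := by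
          rw [mul_assoc (stabSymmetrizer w), ← map_mul, Equiv.swap_mul_eq_mul_swap, map_mul]
          simp only [mul_assoc]
      _ = -X := by
          rw [of_mul_colAntisymmetrizer ht', hsgn, Units.val_neg, Units.val_one, Int.cast_neg,
            Int.cast_one, mul_smul_comm, neg_smul, one_smul]
  have h2 : (2 : ℂ) • X = 0 := by
    rw [two_smul]
    nth_rewrite 2 [hneg]
    exact add_neg_cancel X
  calc X = (2 : ℂ)⁻¹ • ((2 : ℂ) • X) := (inv_smul_smul₀ two_ne_zero X).symm
    _ = 0 := by rw [h2, smul_zero]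

/-- By linearity: if for *every* `g` two distinct positions with equal letters of `w` lie in one
column of `g T_λ`, then `a_w · z · b_λ = 0` for all `z`.
[cite: FultonHarrisGTM129, Lemma 4.23 (1)] -/
theorem stabSymmetrizer_mul_mul_colAntisymmetrizer_eq_zero {lam : Nat.Partition n} {w : Word N n}
    (h : ∀ g : Equiv.Perm (Fin n), ∃ x y : Fin n,
      x ≠ y ∧ w x = w y ∧ lam.colOf (g⁻¹ x) = lam.colOf (g⁻¹ y))
    (z : MonoidAlgebra ℂ (Equiv.Perm (Fin n))) :
    stabSymmetrizer w * z * colAntisymmetrizer ℂ lam = 0 := by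
  induction z using MonoidAlgebra.induction_on with
  | hM g =>
    obtain ⟨x, y, hxy, hw, hcol⟩ := h g
    exact stabSymmetrizer_mul_of_mul_colAntisymmetrizer_eq_zero hxy hw hcol
  | hadd p q hp hq => rw [mul_add, add_mul, hp, hq, add_zero]
  | hsmul r p hp => rw [mul_smul_comm, smul_mul_assoc, hp, smul_zero]

/-! ### The majorisation property -/

/-- **Majorisation property of the isotypic projectors** (CVZ Rem. 3.33; Fulton, *Young Tableaux*
§8.2): if `(P_λ)_{w,w} ≠ 0` then for every `a` the number of positions of `w` with letter `< a` is
at most the number of boxes in the first `a` rows of `λ`, i.e. `λ₁ + ⋯ + λ_a`; in particular the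
type of `w` is dominated by `λ`. Proof: `(P_λ)_{w,w} ≠ 0` gives a nonzero `Stab(w)`-invariant in
`S^λ`, hence `a_w z b_λ ≠ 0` for some `z`, hence some `g` with no two equal letters of `w ∘ g` in a
column of `T_λ` (the engine), and a column-strict word is dominated (`lowCount_le_of_isColStrict`).
[cite: ChristandlVranaZuiddam2023, Rem. 3.33] -/
theorem card_filter_lt_le_of_wordIsotypicMatrix_diag_ne_zero {lam : Nat.Partition n} {w : Word N n}
    (h : wordIsotypicMatrix N n lam w w ≠ 0) (a : ℕ) :
    (Finset.univ.filter fun p => (w p : ℕ) < a).card ≤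
      (Finset.univ.filter fun j => lam.rowOf j < a).card := by
  classical
  -- the character sum over the stabiliser is nonzero
  have hsum : ∑ σ ∈ stabFinset w, spechtCharacter ℂ lam σ ≠ 0 := by
    intro h0
    apply h
    rw [wordIsotypicMatrix_diag_eq, h0, mul_zero]
  obtain ⟨z, hz⟩ := exists_stabSymmetrizer_mul_mul_colAntisymmetrizer_ne_zero lam w hsum
  -- some `g` has no bad pair
  obtain ⟨g, hg⟩ : ∃ g : Equiv.Perm (Fin n), ∀ x y : Fin n,
      x ≠ y → w x = w y → lam.colOf (g⁻¹ x) ≠ lam.colOf (g⁻¹ y) := by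
    by_contra hne
    push Not at hne
    exact hz (stabSymmetrizer_mul_mul_colAntisymmetrizer_eq_zero hne z)
  -- the word `j ↦ w (g j)` is column-strict for `λ`
  have hI : IsColStrict lam (fun j => w (g j)) := by
    intro j j' hc hr
    by_contra hjj'
    exact hg (g j) (g j') (g.injective.ne hjj') hr (by simpa using hc)
  have hcount : lowCount (fun j => w (g j)) a =
      (Finset.univ.filter fun p => (w p : ℕ) < a).card := by
    unfold lowCount
    exact Finset.card_equiv g fun j => by simp
  rw [← hcount]
  exact lowCount_le_of_isColStrict lam hI a

end Literature.RepresentationTheory.FiniteGroups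

end
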